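import Mathlib.Analysis.Complex.RemovableSingularity
import Mathlib.Analysis.SpecialFunctions.Pow.Deriv
import Mathlib.Analysis.SpecialFunctions.Exponential
import Literature.Analysis.Complex.HadamardGenusZeroProofs
import HarnessLib

/-!
# Lee–Yang zeros in an imaginary cone dominate an even entire function by its curvature at `0`

Topic `Literature/Analysis/Complex` (companion of `HadamardGenusZero(Proofs).lean`).

**Theorem** (`norm_le_exp_sq_of_even_of_zeros_in_cone`, a GHS/Newman-type domination from the
LOCATION of zeros). Let `f : ℂ → ℂ` be entire and EVEN, of order `< 2`
(`‖f z‖ ≤ C exp(‖z‖^σ)`, `σ < 2`), with `f 0 ≠ 0`, and suppose every zero `z` of `f` lies in the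
double cone around the imaginary axis
`(1 + κ) (Re z)² ≤ (1 - κ) (Im z)²` for some `0 < κ` (`κ = 1` is the Lee–Yang situation: all zeros
purely imaginary). Then for every REAL `s`

  `‖f s‖ ≤ ‖f 0‖ · exp( s² / (2κ) · Re (f''(0) / f(0)) )`.

In words: on the real axis `log ‖f‖` is dominated by its second-order Taylor polynomial at `0`, up to
the price `1/κ` of the cone (for `κ = 1`, `s ↦ log ‖f(√u)‖` is concave in `u = s²`). For the
partition function `Z(h) = tr e^{-β(H - hQ)}` of a finite quantum system in a symmetry-odd source
`Q` (even in `h` by the symmetry, Lee–Yang at zero coupling) this is the statement "the linear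
response `χ = Z''(0)/(β|Λ|Z(0))` bounds the full non-linear response": `log Z(s) - log Z(0) ≤ β|Λ| χ s²/(2κ)`
(`Literature/MathematicalPhysics/QuantumLattice/ComplexSourcePartitionFn.lean`). It is the analogue,
for zeros confined to a cone instead of the axis, of Newman's "Lee–Yang implies the GHS-type
inequalities" (Newman 1975, Thm. 3 / §2: `log Z` even with purely imaginary zeros has alternating
Taylor coefficients in `h²`, in particular `u₄ ≤ 0`).

## Proof (all proved here)

* `exists_differentiable_comp_sq` — an even entire `f` is `g(z²)` with `g` entire: `g(w) = f(√w)`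
  with either branch of the square root (`Complex.cpow`), holomorphic off `0` by the chain rule on
  the two slit planes (`Complex.mem_slitPlane_or_neg_mem_slitPlane`), at `0` by Riemann's removable
  singularity theorem (`Complex.analyticAt_of_differentiable_on_punctured_nhds_of_continuousAt`);
  `g` has order `σ/2 < 1`.
* Hadamard's theorem in genus zero (the tree's PROVED
  `Literature.Analysis.Complex.hadamard_genus_zero_zeros`): `g(w)/g(0) = ∏ₙ (1 - bₙ w)`, `Σ‖bₙ‖ < ∞`,
  the non-zero `bₙ` being inverses of zeros `aₙ = zₙ²` of `g`.
* The cone in inverse-square coordinates (`cone_inv_sq`): `(1+κ)x² ≤ (1-κ)y²` for `z = x + iy ≠ 0`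
  iff `κ ‖b‖ ≤ -Re b` for `b = z⁻²`; and the one-factor bound (`norm_one_sub_mul_le_exp_of_cone`):
  `‖1 - b u‖ ≤ exp(u (-Re b)/κ)` for `u ≥ 0` — so `‖f s / f 0‖ ≤ exp((s²/κ) Σₙ (-Re bₙ))`.
* `hasDerivAt_hadamardProduct_zero`: `(∏ₙ (1 - bₙ w))'(0) = -Σₙ bₙ` (second-order bound
  `‖∏(1 + aₙ) - 1 - Σ aₙ‖ ≤ e^{Σ‖aₙ‖} - 1 - Σ‖aₙ‖`, from Mathlib's `Finset.norm_prod_one_add_sub_one_le`),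
  and `f''(0) = 2 g'(0)`; hence `Σₙ (-Re bₙ) = ½ Re (f''(0)/f(0))`.

## References

* T. D. Lee, C. N. Yang, Phys. Rev. 87 (1952) 410 (zeros of the partition function on the
  imaginary field axis).
* C. M. Newman, *Inequalities for Ising models and field theories which obey the Lee–Yang theorem*,
  Comm. Math. Phys. 41 (1975) 1–9, Thm. 3 and §2 (consequences of purely imaginary zeros via the
  Hadamard product).
* J. B. Conway, *Functions of One Complex Variable I* (1978), Ch. XI Thm. 3.4 (Hadamard, genus 0).
-/

noncomputable section

open Filter Set Finset
open _root_.Complex _root_.Topology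

namespace Literature.Analysis.Complex

/-! ### The cone condition in inverse-square coordinates, and the one-factor bound -/

/-- If `z = x + iy ≠ 0` lies in the cone `(1+κ)x² ≤ (1-κ)y²`, then `b = (z²)⁻¹` satisfies
`κ ‖b‖ ≤ -Re b` (indeed `-Re b = (y² - x²)/|z|⁴` and `‖b‖ = 1/|z|²`). [folklore] -/
theorem cone_inv_sq {κ : ℝ} {z : ℂ} (hz : z ≠ 0)
    (hcone : (1 + κ) * z.re ^ 2 ≤ (1 - κ) * z.im ^ 2) :
    κ * ‖(z ^ 2)⁻¹‖ ≤ -((z ^ 2)⁻¹).re := by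
  have hn : 0 < ‖z‖ ^ 2 := by positivity
  have hnz : ‖z‖ ^ 2 = z.re ^ 2 + z.im ^ 2 := by
    rw [← Complex.normSq_eq_norm_sq, Complex.normSq_apply]; ring
  have hz2re : (z ^ 2).re = z.re ^ 2 - z.im ^ 2 := by simp [sq, Complex.mul_re]
  have hnorm2 : ‖z ^ 2‖ = ‖z‖ ^ 2 := norm_pow z 2
  have hnsq2 : Complex.normSq (z ^ 2) = (‖z‖ ^ 2) ^ 2 := by
    rw [Complex.normSq_eq_norm_sq, hnorm2]
  rw [norm_inv, hnorm2, Complex.inv_re, hz2re, hnsq2]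
  rw [show -((z.re ^ 2 - z.im ^ 2) / (‖z‖ ^ 2) ^ 2) = (z.im ^ 2 - z.re ^ 2) / (‖z‖ ^ 2) ^ 2 by ring]
  rw [le_div_iff₀ (by positivity), show κ * (‖z‖ ^ 2)⁻¹ * (‖z‖ ^ 2) ^ 2 = κ * ‖z‖ ^ 2 by
    field_simp]
  rw [hnz]
  nlinarith [hcone]

/-- **One-factor bound.** If `0 < κ`, `κ ‖b‖ ≤ -Re b` and `0 ≤ u`, then
`‖1 - b u‖ ≤ exp(u (-Re b) / κ)`: indeed `‖1 - bu‖² = 1 + 2u(-Re b) + u²‖b‖² ≤ (1 + u(-Re b)/κ)²`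
(using `κ ≤ 1`, forced by `κ‖b‖ ≤ -Re b ≤ ‖b‖` unless `b = 0`). [folklore] -/
theorem norm_one_sub_mul_le_exp_of_cone {κ : ℝ} (hκ : 0 < κ) {b : ℂ} (hb : κ * ‖b‖ ≤ -b.re)
    {u : ℝ} (hu : 0 ≤ u) :
    ‖1 - b * (u : ℂ)‖ ≤ Real.exp (u * (-b.re) / κ) := by
  set p : ℝ := -b.re with hp
  have hp0 : 0 ≤ p := le_trans (by positivity) hb
  have hbn : ‖b‖ ≤ p / κ := by rw [le_div_iff₀ hκ]; linarith
  -- `κ ≤ 1` unless `b = 0`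
  by_cases hb0 : b = 0
  · have h0' : 0 ≤ u * p / κ := div_nonneg (mul_nonneg hu hp0) hκ.le
    have h1 : ‖1 - b * (u : ℂ)‖ = 1 := by simp [hb0]
    rw [h1]
    exact Real.one_le_exp h0'
  have hκ1 : κ ≤ 1 := by
    have h1 : -b.re ≤ ‖b‖ := by
      have := Complex.abs_re_le_norm b
      have := neg_abs_le b.re
      linarith [abs_nonneg b.re, Complex.abs_re_le_norm b, neg_le_abs b.re]
    have h2 : κ * ‖b‖ ≤ 1 * ‖b‖ := by linarith
    exact le_of_mul_le_mul_right h2 (norm_pos_iff.2 hb0)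
  have hsq : ‖1 - b * (u : ℂ)‖ ^ 2 ≤ (1 + u * p / κ) ^ 2 := by
    have hns : ‖1 - b * (u : ℂ)‖ ^ 2 = (1 - u * b.re) ^ 2 + (u * b.im) ^ 2 := by
      rw [← Complex.normSq_eq_norm_sq, Complex.normSq_apply]
      simp [Complex.mul_re, Complex.mul_im]
      ring
    have hbb : b.re ^ 2 + b.im ^ 2 = ‖b‖ ^ 2 := by
      rw [← Complex.normSq_eq_norm_sq, Complex.normSq_apply]; ring
    have hb2 : ‖b‖ ^ 2 ≤ (p / κ) ^ 2 := pow_le_pow_left₀ (norm_nonneg _) hbn 2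
    have hupk : u * p ≤ u * p / κ := by
      rw [le_div_iff₀ hκ]
      nlinarith [mul_nonneg hu hp0]
    rw [hns]
    have hu2 : 0 ≤ u ^ 2 := sq_nonneg u
    calc (1 - u * b.re) ^ 2 + (u * b.im) ^ 2
        = 1 + 2 * (u * p) + u ^ 2 * (b.re ^ 2 + b.im ^ 2) := by rw [hp]; ring
      _ ≤ 1 + 2 * (u * p / κ) + u ^ 2 * (p / κ) ^ 2 := by
          rw [hbb]; nlinarith [mul_le_mul_of_nonneg_left hb2 hu2]
      _ = (1 + u * p / κ) ^ 2 := by ring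
  have hpos : 0 ≤ 1 + u * p / κ := by positivity
  have h1 : ‖1 - b * (u : ℂ)‖ ≤ 1 + u * p / κ :=
    (pow_le_pow_iff_left₀ (norm_nonneg _) hpos two_ne_zero).1 hsq
  calc ‖1 - b * (u : ℂ)‖ ≤ 1 + u * p / κ := h1
    _ ≤ Real.exp (u * p / κ) := by linarith [Real.add_one_le_exp (u * p / κ)]

/-! ### An even entire function is an entire function of `z²` -/

/-- For an even `f`, `f (√w)` does not depend on the branch: if `r² = w` then
`f (w ^ (1/2)) = f r`. [folklore] -/
theorem apply_cpow_two_inv_eq_of_even {f : ℂ → ℂ} (heven : ∀ z, f (-z) = f z) {r w : ℂ}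
    (hr : r ^ 2 = w) : f (w ^ (2⁻¹ : ℂ)) = f r := by
  have hsq : (w ^ (2⁻¹ : ℂ)) ^ 2 = w := by
    have h := Complex.cpow_nat_inv_pow w (n := 2) two_ne_zero
    rwa [Nat.cast_ofNat] at h
  have h : (w ^ (2⁻¹ : ℂ)) ^ 2 = r ^ 2 := by rw [hsq, hr]
  rcases sq_eq_sq_iff_eq_or_eq_neg.1 h with h1 | h1
  · rw [h1]
  · rw [h1, heven]

/-- **Square-root lift of an even entire function.** If `f` is entire and even then
`g(w) := f(w^{1/2})` is entire and `g(z²) = f(z)`; moreover `g 0 = f 0` and a bound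
`‖f z‖ ≤ C exp(‖z‖^σ)` becomes `‖g w‖ ≤ C exp(‖w‖^(σ/2))`. (Chain rule on the two slit planes
`ℂ ∖ (-∞,0]`, `ℂ ∖ [0,∞)`, and Riemann's removable-singularity theorem at `0`.) [folklore] -/
theorem exists_differentiable_comp_sq {f : ℂ → ℂ} (hf : Differentiable ℂ f)
    (heven : ∀ z, f (-z) = f z) :
    ∃ g : ℂ → ℂ, Differentiable ℂ g ∧ (∀ z, g (z ^ 2) = f z) ∧
      (∀ w, g w = f (w ^ (2⁻¹ : ℂ))) := by
  set g : ℂ → ℂ := fun w => f (w ^ (2⁻¹ : ℂ)) with hg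
  have hgsq : ∀ z, g (z ^ 2) = f z := fun z => apply_cpow_two_inv_eq_of_even heven rfl
  -- the other branch: `g w = f (I * (-w)^{1/2})`
  have hsq : ∀ w : ℂ, (w ^ (2⁻¹ : ℂ)) ^ 2 = w := fun w => by
    have h := Complex.cpow_nat_inv_pow w (n := 2) two_ne_zero
    rwa [Nat.cast_ofNat] at h
  have hg2 : ∀ w, g w = f (Complex.I * (-w) ^ (2⁻¹ : ℂ)) := by
    intro w
    refine apply_cpow_two_inv_eq_of_even heven ?_
    rw [mul_pow, hsq, Complex.I_sq]; ring
  -- differentiability off `0`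
  have hdiff_ne : ∀ w : ℂ, w ≠ 0 → DifferentiableAt ℂ g w := by
    intro w hw
    rcases Complex.mem_slitPlane_or_neg_mem_slitPlane hw with h | h
    · exact (hf _).comp w (differentiableAt_id.cpow_const h)
    · have heq : g = fun w => f (Complex.I * (-w) ^ (2⁻¹ : ℂ)) := funext hg2
      rw [heq]
      refine (hf _).comp w ?_
      exact (differentiableAt_id.neg.cpow_const h).const_mul _
  -- continuity at `0`
  have hcont : ContinuousAt g 0 := by
    have h0 : (0 : ℂ) ^ (2⁻¹ : ℂ) = 0 := Complex.zero_cpow (by norm_num)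
    have hroot : Tendsto (fun w : ℂ => w ^ (2⁻¹ : ℂ)) (𝓝 0) (𝓝 0) := by
      rw [tendsto_zero_iff_norm_tendsto_zero]
      have hnorm : ∀ w : ℂ, ‖w ^ (2⁻¹ : ℂ)‖ = Real.sqrt ‖w‖ := by
        intro w
        rw [show (2⁻¹ : ℂ) = ((2⁻¹ : ℝ) : ℂ) by norm_num, Complex.norm_cpow_real,
          Real.sqrt_eq_rpow, one_div]
      simp_rw [hnorm]
      have hc : Continuous fun w : ℂ => Real.sqrt ‖w‖ := Real.continuous_sqrt.comp continuous_norm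
      have := hc.tendsto (0 : ℂ)
      simpa using this
    have hfc : ContinuousAt f 0 := (hf 0).continuousAt
    have : Tendsto g (𝓝 0) (𝓝 (f 0)) := by
      have h := hfc.tendsto.comp hroot
      exact h
    rw [ContinuousAt, show g 0 = f 0 by simp [hg, h0]]
    exact this
  have hdiff0 : DifferentiableAt ℂ g 0 := by
    refine (Complex.analyticAt_of_differentiable_on_punctured_nhds_of_continuousAt ?_ hcont)
      |>.differentiableAt
    exact eventually_nhdsWithin_of_forall fun w hw => hdiff_ne w hw
  refine ⟨g, fun w => ?_, hgsq, fun w => rfl⟩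
  by_cases hw : w = 0
  · rw [hw]; exact hdiff0
  · exact hdiff_ne w hw

/-- Growth transfer to the square-root lift: `‖f z‖ ≤ C exp(‖z‖^σ)` for all `z` gives
`‖f (w^{1/2})‖ ≤ C exp(‖w‖^(σ/2))`. [folklore] -/
theorem norm_apply_cpow_two_inv_le {f : ℂ → ℂ} {C σ : ℝ}
    (hgr : ∀ z, ‖f z‖ ≤ C * Real.exp (‖z‖ ^ σ)) (w : ℂ) :
    ‖f (w ^ (2⁻¹ : ℂ))‖ ≤ C * Real.exp (‖w‖ ^ (σ / 2)) := by
  have h := hgr (w ^ (2⁻¹ : ℂ))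
  have hnorm : ‖w ^ (2⁻¹ : ℂ)‖ = ‖w‖ ^ (2⁻¹ : ℝ) := by
    rw [show (2⁻¹ : ℂ) = ((2⁻¹ : ℝ) : ℂ) by norm_num, Complex.norm_cpow_real]
  rw [hnorm, ← Real.rpow_mul (norm_nonneg _)] at h
  rwa [show (2⁻¹ : ℝ) * σ = σ / 2 by ring] at h

/-! ### The derivative of a genus-zero Hadamard product at the origin -/

/-- Second-order remainder of a finite product: `‖∏ (1 + aᵢ) - 1 - Σ aᵢ‖ ≤ e^{Σ‖aᵢ‖} - 1 - Σ‖aᵢ‖`.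
[folklore] -/
theorem norm_prod_one_add_sub_one_sub_sum_le {ι : Type*} [DecidableEq ι] (t : Finset ι)
    (a : ι → ℂ) :
    ‖∏ i ∈ t, (1 + a i) - 1 - ∑ i ∈ t, a i‖ ≤
      Real.exp (∑ i ∈ t, ‖a i‖) - 1 - ∑ i ∈ t, ‖a i‖ := by
  induction t using Finset.induction_on with
  | empty => simp
  | insert m t hm ih =>
    rw [Finset.prod_insert hm, Finset.sum_insert hm, Finset.sum_insert hm]
    have h1 := Finset.norm_prod_one_add_sub_one_le t a
    set P := ∏ i ∈ t, (1 + a i)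
    set S := ∑ i ∈ t, a i
    set T := ∑ i ∈ t, ‖a i‖
    have hsplit : (1 + a m) * P - 1 - (a m + S) = (P - 1 - S) + a m * (P - 1) := by ring
    rw [hsplit]
    have hT0 : 0 ≤ T := Finset.sum_nonneg fun i _ => norm_nonneg _
    calc ‖P - 1 - S + a m * (P - 1)‖ ≤ ‖P - 1 - S‖ + ‖a m‖ * ‖P - 1‖ := by
          refine (norm_add_le _ _).trans ?_; rw [norm_mul]
      _ ≤ (Real.exp T - 1 - T) + ‖a m‖ * (Real.exp T - 1) := by
          gcongr
      _ ≤ Real.exp (‖a m‖ + T) - 1 - (‖a m‖ + T) := by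
          rw [Real.exp_add]
          nlinarith [Real.add_one_le_exp ‖a m‖, norm_nonneg (a m), Real.exp_pos T,
            Real.add_one_le_exp T, mul_nonneg (norm_nonneg (a m)) hT0]

/-- **Derivative of a genus-zero canonical product at the origin.** If `Σ‖bₙ‖ < ∞` and
`G w = ∏ₙ (1 - bₙ w)` for all `w`, then `G'(0) = -Σₙ bₙ`. [cite: Conway1978, Ch. XI] [folklore] -/
theorem hasDerivAt_hadamardProduct_zero {b : ℕ → ℂ} (hb : Summable fun n => ‖b n‖) {G : ℂ → ℂ}
    (hG : ∀ w : ℂ, HasProd (fun n => 1 - b n * w) (G w)) :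
    HasDerivAt G (-∑' n, b n) 0 := by
  set B : ℝ := ∑' n, ‖b n‖ with hB
  have hB0 : 0 ≤ B := tsum_nonneg fun n => norm_nonneg _
  have hbs : Summable b := hb.of_norm
  -- the remainder bound `‖G w - 1 + (Σ b) w‖ ≤ e^{‖w‖B} - 1 - ‖w‖B`
  have hrem : ∀ w : ℂ, ‖G w - 1 - (-(∑' n, b n) * w)‖ ≤
      Real.exp (‖w‖ * B) - 1 - ‖w‖ * B := by
    intro w
    set a : ℕ → ℂ := fun n => -(b n * w) with ha
    have has : HasSum a (-(∑' n, b n) * w) := by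
      have h1 : HasSum (fun n => b n * w) ((∑' n, b n) * w) := hbs.hasSum.mul_right w
      simpa [ha, neg_mul] using h1.neg
    have hprod : Tendsto (fun t : Finset ℕ => ∏ n ∈ t, (1 + a n)) atTop (𝓝 (G w)) := by
      have h := hG w
      simp only [HasProd, SummationFilter.unconditional_filter] at h
      refine h.congr' (Eventually.of_forall fun t => Finset.prod_congr rfl fun n _ => ?_)
      simp [ha, sub_eq_add_neg]
    have hsum : Tendsto (fun t : Finset ℕ => ∑ n ∈ t, a n) atTop (𝓝 (-(∑' n, b n) * w)) := by
      have h := has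
      simp only [HasSum, SummationFilter.unconditional_filter] at h
      exact h
    have hlim : Tendsto (fun t : Finset ℕ => ‖∏ n ∈ t, (1 + a n) - 1 - ∑ n ∈ t, a n‖) atTop
        (𝓝 ‖G w - 1 - (-(∑' n, b n) * w)‖) :=
      ((hprod.sub tendsto_const_nhds).sub hsum).norm
    refine le_of_tendsto' hlim fun t => ?_
    refine (norm_prod_one_add_sub_one_sub_sum_le t a).trans ?_
    -- monotonicity of `x ↦ e^x - 1 - x` on `[0, ∞)` and `Σ_t ‖aₙ‖ ≤ ‖w‖ B`
    have hna : ∀ n, ‖a n‖ = ‖w‖ * ‖b n‖ := fun n => by simp [ha, mul_comm]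
    have hle : ∑ n ∈ t, ‖a n‖ ≤ ‖w‖ * B := by
      simp_rw [hna, ← Finset.mul_sum]
      exact mul_le_mul_of_nonneg_left
        (hb.sum_le_tsum t fun n _ => norm_nonneg _) (norm_nonneg _)
    have h0 : 0 ≤ ∑ n ∈ t, ‖a n‖ := Finset.sum_nonneg fun n _ => norm_nonneg _
    -- `e^y - 1 - y - (e^x - 1 - x) = (e^y - e^x) - (y - x) ≥ 0` for `0 ≤ x ≤ y`
    set x := ∑ n ∈ t, ‖a n‖
    set y := ‖w‖ * B
    have hxy : Real.exp x - 1 - x ≤ Real.exp y - 1 - y := by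
      have hmv : y - x ≤ Real.exp y - Real.exp x := by
        have h1 : Real.exp x * (y - x) + Real.exp x ≤ Real.exp y := by
          have := Real.add_one_le_exp (y - x)
          have h2 : Real.exp y = Real.exp x * Real.exp (y - x) := by
            rw [← Real.exp_add]; ring_nf
          rw [h2]; nlinarith [Real.exp_pos x]
        nlinarith [Real.add_one_le_exp x, h0]
      linarith
    exact hxy
  -- conclude with the little-o characterisation
  have hG0 : G 0 = 1 := by
    have h := hG 0
    simp only [mul_zero, sub_zero] at h
    exact h.unique hasProd_one
  rw [hasDerivAt_iff_isLittleO, Asymptotics.isLittleO_iff]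
  intro ε hε
  -- for `‖w‖ B ≤ 1`: remainder `≤ (‖w‖B)²`; choose `‖w‖ ≤ ε / (B² + 1)` as well
  have hball : ∀ᶠ w in 𝓝 (0 : ℂ), ‖w‖ * (B + 1) ≤ 1 ∧ ‖w‖ * (B ^ 2 + 1) ≤ ε := by
    have h1 : ∀ᶠ w in 𝓝 (0 : ℂ), ‖w‖ ≤ min (1 / (B + 1)) (ε / (B ^ 2 + 1)) := by
      have hpos : 0 < min (1 / (B + 1)) (ε / (B ^ 2 + 1)) := by positivity
      rw [Metric.eventually_nhds_iff]
      exact ⟨_, hpos, fun w hw => by simpa [dist_zero_right] using hw.le⟩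
    filter_upwards [h1] with w hw
    constructor
    · have := (le_min_iff.1 hw).1
      rwa [le_div_iff₀ (by positivity)] at this
    · have := (le_min_iff.1 hw).2
      rwa [le_div_iff₀ (by positivity)] at this
  filter_upwards [hball] with w hw
  rw [hG0, sub_zero, smul_eq_mul, mul_comm (w : ℂ)]
  have hwB1 : ‖w‖ * B ≤ 1 := by nlinarith [norm_nonneg w, hw.1]
  have hwB0 : 0 ≤ ‖w‖ * B := mul_nonneg (norm_nonneg _) hB0
  calc ‖G w - 1 - -(∑' n, b n) * w‖ ≤ Real.exp (‖w‖ * B) - 1 - ‖w‖ * B := hrem w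
    _ ≤ (‖w‖ * B) ^ 2 := by
        have h := Real.abs_exp_sub_one_sub_id_le (x := ‖w‖ * B) (by rw [abs_of_nonneg hwB0]; exact hwB1)
        exact le_trans (le_abs_self _) h
    _ = (‖w‖ * B ^ 2) * ‖w‖ := by ring
    _ ≤ ε * ‖w‖ := by
        refine mul_le_mul_of_nonneg_right ?_ (norm_nonneg _)
        nlinarith [hw.2, norm_nonneg w, sq_nonneg B]

/-! ### The domination theorem -/

/-- **Zeros in an imaginary cone dominate an even entire function by its curvature at the origin**
(Lee–Yang ⇒ GHS/Newman-type bound, cone version). Let `f` be entire with `‖f z‖ ≤ C exp(‖z‖^σ)`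
for some `σ < 2`, even, `f 0 ≠ 0`, and assume every zero `z` of `f` satisfies
`(1 + κ)(Re z)² ≤ (1 - κ)(Im z)²` for some `κ > 0` (`κ = 1`: all zeros purely imaginary). Then for all
real `s`, `‖f s‖ ≤ ‖f 0‖ exp(s²/(2κ) · Re(f''(0)/f(0)))`.
[cite: Newman1975, Thm. 3] [cite: Conway1978, Ch. XI Thm. 3.4] -/
theorem norm_le_exp_sq_of_even_of_zeros_in_cone {f : ℂ → ℂ} (hf : Differentiable ℂ f)
    {C σ : ℝ} (hσ : σ < 2) (hgr : ∀ z, ‖f z‖ ≤ C * Real.exp (‖z‖ ^ σ))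
    (heven : ∀ z, f (-z) = f z) (h0 : f 0 ≠ 0) {κ : ℝ} (hκ : 0 < κ)
    (hcone : ∀ z, f z = 0 → (1 + κ) * z.re ^ 2 ≤ (1 - κ) * z.im ^ 2) (s : ℝ) :
    ‖f s‖ ≤ ‖f 0‖ * Real.exp (s ^ 2 / (2 * κ) * (iteratedDeriv 2 f 0 / f 0).re) := by
  -- the square-root lift
  obtain ⟨g, hg, hgsq, hgdef⟩ := exists_differentiable_comp_sq hf heven
  have hg0 : g 0 = f 0 := by simpa using hgsq 0
  have hg0' : g 0 ≠ 0 := hg0 ▸ h0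
  have hggr : ∀ w, ‖g w‖ ≤ C * Real.exp (‖w‖ ^ (σ / 2)) := fun w => by
    rw [hgdef]; exact norm_apply_cpow_two_inv_le hgr w
  -- Hadamard in genus zero for `g`
  obtain ⟨b, hb, hbzero, -, hprod⟩ :=
    hadamard_genus_zero_zeros g (σ / 2) C hg (by linarith) hggr hg0'
  -- the cone condition in `b`-coordinates
  have hbcone : ∀ n, κ * ‖b n‖ ≤ -(b n).re := by
    intro n
    by_cases hbn : b n = 0
    · simp [hbn]
    have hga : g (b n)⁻¹ = 0 := hbzero n hbn
    set z : ℂ := ((b n)⁻¹) ^ (2⁻¹ : ℂ) with hz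
    have hz2 : z ^ 2 = (b n)⁻¹ := by
      have h := Complex.cpow_nat_inv_pow (b n)⁻¹ (n := 2) two_ne_zero
      rwa [Nat.cast_ofNat] at h
    have hfz : f z = 0 := by rw [← hgsq z, hz2, hga]
    have hz0 : z ≠ 0 := by
      intro h
      have : (b n)⁻¹ = 0 := by rw [← hz2, h]; simp
      exact hbn (inv_eq_zero.1 this)
    have h := cone_inv_sq hz0 (hcone z hfz)
    rwa [hz2, inv_inv] at h
  -- summability of `-Re bₙ` and its sum
  have hbre : Summable fun n => -(b n).re := by
    refine Summable.of_norm_bounded hb fun n => ?_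
    rw [Real.norm_eq_abs, abs_neg]
    exact (Complex.abs_re_le_norm _)
  have hbre0 : ∀ n, 0 ≤ -(b n).re := fun n => le_trans (by positivity) (hbcone n)
  set T : ℝ := ∑' n, -(b n).re with hT
  -- Step 1: `‖f s / f 0‖ ≤ exp (s² T / κ)`
  have hmain : ‖f s / f 0‖ ≤ Real.exp (s ^ 2 * T / κ) := by
    have hP : HasProd (fun n => 1 - b n * ((s : ℂ) ^ 2)) (f s / f 0) := by
      have h := hprod ((s : ℂ) ^ 2)
      rwa [hgsq, hg0] at h
    have hPn : HasProd (fun n => ‖1 - b n * ((s : ℂ) ^ 2)‖) ‖f s / f 0‖ :=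
      hP.map normHom continuous_norm
    have ht : Tendsto (fun t : Finset ℕ => ∏ n ∈ t, ‖1 - b n * ((s : ℂ) ^ 2)‖) atTop
        (𝓝 ‖f s / f 0‖) := by
      simpa only [HasProd, SummationFilter.unconditional_filter] using hPn
    refine le_of_tendsto' ht fun t => ?_
    have hfac : ∀ n, ‖1 - b n * ((s : ℂ) ^ 2)‖ ≤ Real.exp (s ^ 2 * (-(b n).re) / κ) := by
      intro n
      have h := norm_one_sub_mul_le_exp_of_cone hκ (hbcone n) (sq_nonneg s)
      simpa using h
    calc ∏ n ∈ t, ‖1 - b n * ((s : ℂ) ^ 2)‖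
        ≤ ∏ n ∈ t, Real.exp (s ^ 2 * (-(b n).re) / κ) :=
          Finset.prod_le_prod (fun n _ => norm_nonneg _) fun n _ => hfac n
      _ = Real.exp (∑ n ∈ t, s ^ 2 * (-(b n).re) / κ) := (Real.exp_sum _ _).symm
      _ ≤ Real.exp (s ^ 2 * T / κ) := by
          refine Real.exp_le_exp.2 ?_
          have hsum : ∑ n ∈ t, -(b n).re ≤ T := hbre.sum_le_tsum t fun n _ => hbre0 n
          have : ∑ n ∈ t, s ^ 2 * (-(b n).re) / κ = s ^ 2 / κ * ∑ n ∈ t, -(b n).re := by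
            rw [Finset.mul_sum]; refine Finset.sum_congr rfl fun n _ => ?_; ring
          rw [this, show s ^ 2 * T / κ = s ^ 2 / κ * T by ring]
          exact mul_le_mul_of_nonneg_left hsum (by positivity)
  -- Step 2: `T = ½ Re (f''(0)/f(0))`
  have hT_eq : T = (1 / 2) * (iteratedDeriv 2 f 0 / f 0).re := by
    -- `G = g / g 0` has `G'(0) = -Σ bₙ`
    have hGd : HasDerivAt (fun w => g w / g 0) (-∑' n, b n) 0 :=
      hasDerivAt_hadamardProduct_zero hb hprod
    have hgd : deriv g 0 = -(∑' n, b n) * g 0 := by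
      have h1 : HasDerivAt (fun w => g w / g 0) (deriv g 0 / g 0) 0 :=
        (hg 0).hasDerivAt.div_const (g 0)
      have h2 := h1.unique hGd
      field_simp at h2
      linear_combination h2
    -- `f''(0) = 2 g'(0)`
    have hf2 : iteratedDeriv 2 f 0 = 2 * deriv g 0 := by
      have hfg : f = fun z => g (z ^ 2) := funext fun z => (hgsq z).symm
      have hd1 : ∀ z, HasDerivAt f (deriv g (z ^ 2) * (2 * z)) z := by
        intro z
        rw [hfg]
        have h := (hg (z ^ 2)).hasDerivAt.comp z (hasDerivAt_pow 2 z)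
        refine h.congr_deriv ?_
        simp [pow_one]
      have hderiv : deriv f = fun z => deriv g (z ^ 2) * (2 * z) := funext fun z => (hd1 z).deriv
      rw [iteratedDeriv_succ, iteratedDeriv_one, hderiv]
      have hdg : DifferentiableAt ℂ (deriv g) (0 ^ 2) :=
        ((hg.analyticAt _).deriv).differentiableAt
      have h3 : HasDerivAt (fun z : ℂ => deriv g (z ^ 2) * (2 * z))
          (deriv (deriv g) (0 ^ 2) * (2 * 0) * (2 * 0) + deriv g (0 ^ 2) * 2) 0 := by
        have ha : HasDerivAt (fun z : ℂ => deriv g (z ^ 2)) (deriv (deriv g) (0 ^ 2) * (2 * 0)) 0 := by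
          have h := hdg.hasDerivAt.comp (0 : ℂ) (hasDerivAt_pow 2 (0 : ℂ))
          refine h.congr_deriv ?_
          simp
        have hb' : HasDerivAt (fun z : ℂ => 2 * z) 2 0 := by
          simpa using (hasDerivAt_id (0 : ℂ)).const_mul 2
        exact ha.mul hb'
      rw [h3.deriv]
      simp
      ring
    have hre : (∑' n, b n).re = ∑' n, (b n).re := Complex.re_tsum hb.of_norm
    have hTsum : T = -(∑' n, (b n).re) := by
      rw [hT, tsum_neg]
    rw [hTsum, ← hre, hf2, hgd, hg0]
    have hf0 : f 0 ≠ 0 := h0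
    field_simp
    simp [Complex.neg_re]
    ring
  -- conclusion
  have hfn : ‖f s‖ = ‖f 0‖ * ‖f s / f 0‖ := by
    rw [norm_div, mul_div_cancel₀ _ (norm_ne_zero_iff.2 h0)]
  rw [hfn]
  refine mul_le_mul_of_nonneg_left (hmain.trans (le_of_eq ?_)) (norm_nonneg _)
  rw [hT_eq]
  congr 1
  ring

end Literature.Analysis.Complex
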